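/-
Copyright: cell `pub-ymgap` (HUMAN RULING D-0062), Track A of `YM-PLAN.md`, DAG node N20 (= NE7b); R134 acceleration seat
`pub-ymgap-dag-n20-c` (strategy s1, generation 2), module 9.  Released under the licence of the surrounding project.
-/
import Summits.QuantumFields.YangMills.Theorems.BalabanUVNodesN20LCSRestrictedRP
import Literature.MathematicalPhysics.QuantumFieldTheory.Balaban1983to89.TorusHypercubicSymmetry
import Mathlib.Algebra.QuadraticDiscriminant
import HarnessLib

/-!
# YM-DAG node N20 (= NE7b), strategy s1, module 9: THE REFLECTION CAUCHY–SCHWARZ INEQUALITY of the plaquette-weighted (in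
# particular small-field-RESTRICTED) level-0 state of record — the `hCS` input a conditional chessboard consumes

Track A of `YM-PLAN.md` (cell `pub-ymgap`, HUMAN RULING D-0062), node **N20** = spine estimate NE7b (`T4WeightBudget.RelWeightBound` — the
cell `pub-balaban`'s OWN estimate, NOT PRINTED in [Bałaban 1983–89], NOT PROVED).  Seat `pub-ymgap-dag-n20-c` (R134, s1), module 9
(module 8: `…Theorems.BalabanUVNodesN20LCSRestrictedRP`, reflection positivity of the weighted level-0 state).  Kernel theorems only: 0 `def`,
0 `sorry`, standard axioms; COUNT-NEUTRAL; `--supports` the K3 item `SpineGivenEndpointR11` (stmt-QuantumFields-19676).  Nothing of Bałaban's is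
asserted: the objects are the cell's (`Missing.expect`, `GaugeField.negReflect`, `PosHalfSupported`), read BY NAME.

WHY.  A chessboard estimate for the restricted state (located residual (ii) of the seat's triage) consumes, per reflection, the REFLECTION
CAUCHY–SCHWARZ inequality `⟨(A∘Θ)·B⟩² ≤ ⟨(A∘Θ)·A⟩·⟨(B∘Θ)·B⟩` of the state (the binder `hCS` of `FdVOC22MultiReflectionBound.chessboard_of_reflectionCS`,
there for a `Measure`).  Module 8 gave POSITIVITY of the weighted pairing; THIS FILE adds its SYMMETRY (the site reflection `Θ'` is an exact
symmetry of the torus expectation, `TorusHypercubicSymmetry.Missing.expect_negReflect`, an involution, and fixes the all-plaquette weight —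
`prod_plaqWeight_negReflect` from `reTr_plaqHol_reflect` + `Plaq.reflectEquiv`) and BILINEARITY (`expect_add_of_integrable`, `expect_const_mul`),
and concludes Cauchy–Schwarz by the discriminant of `t ↦ ⟨((A + tB)∘Θ')·(A + tB)·∏w⟩ ≥ 0` (`discrim_le_zero`):
* `prod_plaqWeight_negReflect`, `expect_add_of_integrable`, `expect_const_mul`, **`expect_negReflect_pairing_symm`**
  (`⟨(A∘Θ')·B·∏_p w⟩ = ⟨(B∘Θ')·A·∏_p w⟩`), ★ **`expect_negReflect_pairing_sq_le`** — for `β ≥ 0`, a non-negative bounded measurable weight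
  `w` and bounded measurable positive-half-supported real `A`, `B`:
  `⟨(A∘Θ')·B·∏_p w(1 − Re tr U(∂p))⟩² ≤ ⟨(A∘Θ')·A·∏_p w⟩ · ⟨(B∘Θ')·B·∏_p w⟩`.

* §2 (v1.1) EVERY SITE HYPERPLANE: `prod_plaqWeight_translate`, `translate_translate_neg`, **`expect_conjTranslateNegReflect_mul_mul_prod_nonneg`**,
  **`expect_conjTranslate_pairing_sq_le`** — positivity and Cauchy–Schwarz for the translation conjugates `τ_a ∘ Θ' ∘ τ_{−a}` (reflections in
  the hyperplanes `t = a₀`, `t = a₀ + N₀∕2`), by `Missing.expect_translate`.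
* §3 (v1.1) `posHalfSupported_prod_of_pos`, `measurable_prod_plaq`, `abs_prod_plaq_le`, **`expect_negReflect_prodPos_sq_le`** — §1 for products
  of a one-plaquette function over POSITIVE plaquettes (the chessboard step's input shape).

HONEST FRAMING.  Level 0, time-axis site reflections at every hyperplane (other axes: module 8 §3 by `configPerm`∕`permute` symmetry); the chessboard ITERATION for
site reflections and the restricted uniform doubling remain the located residuals (ii)(b)∕(c); levels `≥ 1`, residual (i), (iv) untouched.
NE7b NOT PRINTED ∕ NOT PROVED; (α)-instance 0∕1; N20 NOT discharged; typed 28∕28, discharged count untouched; one finite four-torus at fixed `ε` —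
NOT ℝ⁴, NOT infinite volume, NOT OS axioms for fields, NOT a mass gap, NOT Clay.
-/

set_option autoImplicit false

noncomputable section

namespace Summit.QuantumFields.YangMills.BalabanUVNodes.N20LCSRestrictedRPCauchySchwarz

open MeasureTheory
open Literature.MathematicalPhysics.QuantumFieldTheory
open Literature.MathematicalPhysics.QuantumFieldTheory.Balaban1983to89
open Summit.QuantumFields.YangMills.BalabanUVNodes.N20LCSRestrictedRP (expect_negReflect_mul_mul_prod_nonneg)

section CauchySchwarz

variable {N : ℕ} [NeZero N]

/-- The all-plaquette weight is invariant under the site reflection `Θ'` (`negReflect_eq_reflect_zero`, `reTr_plaqHol_reflect`,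
`Plaq.reflectEquiv`). [folklore] -/
theorem prod_plaqWeight_negReflect (P : Params) (w : ℝ → ℝ) (V : GaugeField P 0 (Matrix.specialUnitaryGroup (Fin N) ℂ)) :
    ∏ p : Plaq P 0, w (1 - reTr (GaugeField.plaqHol V.negReflect p)) =
      ∏ p : Plaq P 0, w (1 - reTr (GaugeField.plaqHol V p)) := by
  rw [GaugeField.negReflect_eq_reflect_zero]
  simp_rw [GaugeField.reTr_plaqHol_reflect]
  exact Fintype.prod_equiv (Plaq.reflectEquiv 0) _ _ fun p => rfl

/-- Additivity of the torus expectation on observables integrable against the Boltzmann weight. [folklore] -/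
theorem expect_add_of_integrable (P : Params) (β : ℝ) {f g : GaugeField P 0 (Matrix.specialUnitaryGroup (Fin N) ℂ) → ℝ}
    (hf : Integrable (fun U => f U * Missing.boltzmann P β U) (fieldMeasure P 0 (Matrix.specialUnitaryGroup (Fin N) ℂ)))
    (hg : Integrable (fun U => g U * Missing.boltzmann P β U) (fieldMeasure P 0 (Matrix.specialUnitaryGroup (Fin N) ℂ))) :
    Missing.expect (G := Matrix.specialUnitaryGroup (Fin N) ℂ) P β (fun U => f U + g U) =
      Missing.expect (G := Matrix.specialUnitaryGroup (Fin N) ℂ) P β f + Missing.expect (G := Matrix.specialUnitaryGroup (Fin N) ℂ) P β g := by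
  unfold Missing.expect
  rw [← add_div]
  congr 1
  simp_rw [add_mul]
  exact integral_add hf hg

/-- Homogeneity of the torus expectation. [folklore] -/
theorem expect_const_mul (P : Params) (β c : ℝ) (f : GaugeField P 0 (Matrix.specialUnitaryGroup (Fin N) ℂ) → ℝ) :
    Missing.expect (G := Matrix.specialUnitaryGroup (Fin N) ℂ) P β (fun U => c * f U) =
      c * Missing.expect (G := Matrix.specialUnitaryGroup (Fin N) ℂ) P β f := by
  unfold Missing.expect
  simp_rw [mul_assoc]
  rw [integral_const_mul, mul_div_assoc]

/-- **SYMMETRY OF THE WEIGHTED REFLECTION PAIRING**: `⟨(A∘Θ')·B·∏w⟩ = ⟨(B∘Θ')·A·∏w⟩` (`Θ'` is an exact symmetry of the expectation,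
`Missing.expect_negReflect`; an involution, `GaugeField.negReflect_negReflect`; the weight is `Θ'`-invariant). [folklore] -/
theorem expect_negReflect_pairing_symm (P : Params) (β : ℝ) (w : ℝ → ℝ)
    (A B : GaugeField P 0 (Matrix.specialUnitaryGroup (Fin N) ℂ) → ℝ) :
    Missing.expect (G := Matrix.specialUnitaryGroup (Fin N) ℂ) P β
        (fun U => A U.negReflect * B U * ∏ p : Plaq P 0, w (1 - reTr (GaugeField.plaqHol U p))) =
      Missing.expect (G := Matrix.specialUnitaryGroup (Fin N) ℂ) P β
        (fun U => B U.negReflect * A U * ∏ p : Plaq P 0, w (1 - reTr (GaugeField.plaqHol U p))) := by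
  rw [← Missing.expect_negReflect P β (fun U => A U.negReflect * B U * ∏ p : Plaq P 0, w (1 - reTr (GaugeField.plaqHol U p)))]
  congr 1
  funext U
  simp only [GaugeField.negReflect_negReflect, prod_plaqWeight_negReflect]
  ring

/-- **REFLECTION CAUCHY–SCHWARZ FOR THE PLAQUETTE-WEIGHTED (IN PARTICULAR SMALL-FIELD-RESTRICTED) LEVEL-0 STATE**: for bounded
measurable positive-half-supported real `A`, `B` and a non-negative bounded measurable weight `w`,
`⟨(A∘Θ')·B·∏_p w⟩² ≤ ⟨(A∘Θ')·A·∏_p w⟩ · ⟨(B∘Θ')·B·∏_p w⟩` — positivity (`expect_negReflect_mul_mul_prod_nonneg` at `A + tB`),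
symmetry and bilinearity of the pairing, discriminant.  This is the `hCS` input a chessboard iteration consumes
(`FdVOC22MultiReflectionBound.chessboard_of_reflectionCS`'s binder shape, there for a `Measure`). [folklore] -/
theorem expect_negReflect_pairing_sq_le (P : Params) {β : ℝ} (hβ : 0 ≤ β) {w : ℝ → ℝ} (hw0 : ∀ t, 0 ≤ w t) (hwm : Measurable w)
    (hwb : ∃ K : ℝ, ∀ t, w t ≤ K)
    {A B : GaugeField P 0 (Matrix.specialUnitaryGroup (Fin N) ℂ) → ℝ} (hA : Measurable A) (hAb : ∃ C : ℝ, ∀ U, |A U| ≤ C)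
    (hApos : PosHalfSupported A) (hB : Measurable B) (hBb : ∃ C : ℝ, ∀ U, |B U| ≤ C) (hBpos : PosHalfSupported B) :
    Missing.expect (G := Matrix.specialUnitaryGroup (Fin N) ℂ) P β
        (fun U => A U.negReflect * B U * ∏ p : Plaq P 0, w (1 - reTr (GaugeField.plaqHol U p))) ^ 2 ≤
      Missing.expect (G := Matrix.specialUnitaryGroup (Fin N) ℂ) P β
          (fun U => A U.negReflect * A U * ∏ p : Plaq P 0, w (1 - reTr (GaugeField.plaqHol U p))) *
        Missing.expect (G := Matrix.specialUnitaryGroup (Fin N) ℂ) P β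
          (fun U => B U.negReflect * B U * ∏ p : Plaq P 0, w (1 - reTr (GaugeField.plaqHol U p))) := by
  obtain ⟨K, hK⟩ := hwb
  obtain ⟨CA, hCA⟩ := hAb
  obtain ⟨CB, hCB⟩ := hBb
  set D : GaugeField P 0 (Matrix.specialUnitaryGroup (Fin N) ℂ) → ℝ :=
    fun U => ∏ p : Plaq P 0, w (1 - reTr (GaugeField.plaqHol U p)) with hD
  -- measurability and bounds
  have hθm : Measurable (GaugeField.negReflect (P := P) (G := Matrix.specialUnitaryGroup (Fin N) ℂ)) :=
    GaugeField.measurable_negReflect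
  have hDm : Measurable D := Finset.measurable_prod _ fun p _ =>
    hwm.comp (measurable_const.sub (RegularGaugeGroup.measurable_reTr.comp (Missing.measurable_plaqHol p)))
  have hK0 : 0 ≤ K := (hw0 0).trans (hK 0)
  have hDb : ∀ U, |D U| ≤ K ^ (Finset.univ : Finset (Plaq P 0)).card := fun U => by
    rw [hD, Finset.abs_prod, ← Finset.prod_const]
    exact Finset.prod_le_prod (fun p _ => abs_nonneg _) fun p _ => by rw [abs_of_nonneg (hw0 _)]; exact hK _
  -- the pairing and its integrability
  have hint : ∀ (X Y : GaugeField P 0 (Matrix.specialUnitaryGroup (Fin N) ℂ) → ℝ), Measurable X → Measurable Y →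
      ∀ (CX CY : ℝ), (∀ U, |X U| ≤ CX) → (∀ U, |Y U| ≤ CY) →
      Integrable (fun U => (X U.negReflect * Y U * D U) * Missing.boltzmann P β U)
        (fieldMeasure P 0 (Matrix.specialUnitaryGroup (Fin N) ℂ)) := by
    intro X Y hX hY CX CY hXb hYb
    refine Missing.integrable_mul_boltzmann RegularGaugeGroup.measurable_reTr hβ (((hX.comp hθm).mul hY).mul hDm)
      (C := CX * CY * K ^ (Finset.univ : Finset (Plaq P 0)).card) fun U => ?_
    rw [abs_mul, abs_mul]
    have hCX : 0 ≤ CX := (abs_nonneg _).trans (hXb U)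
    exact mul_le_mul (mul_le_mul (hXb _) (hYb _) (abs_nonneg _) hCX) (hDb U) (abs_nonneg _)
      (mul_nonneg hCX ((abs_nonneg _).trans (hYb U)))
  -- abbreviations for the four pairings
  set pAB := Missing.expect (G := Matrix.specialUnitaryGroup (Fin N) ℂ) P β (fun U => A U.negReflect * B U * D U) with hpAB
  set pBA := Missing.expect (G := Matrix.specialUnitaryGroup (Fin N) ℂ) P β (fun U => B U.negReflect * A U * D U) with hpBA
  set pAA := Missing.expect (G := Matrix.specialUnitaryGroup (Fin N) ℂ) P β (fun U => A U.negReflect * A U * D U) with hpAA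
  set pBB := Missing.expect (G := Matrix.specialUnitaryGroup (Fin N) ℂ) P β (fun U => B U.negReflect * B U * D U) with hpBB
  have hsymm : pBA = pAB := (expect_negReflect_pairing_symm P β w A B).symm
  -- positivity of the pairing on `A + t·B` for every real `t`
  have hquad : ∀ t : ℝ, 0 ≤ pBB * (t * t) + (2 * pAB) * t + pAA := by
    intro t
    have hXm : Measurable fun U => A U + t * B U := hA.add (hB.const_mul t)
    have hXb : ∃ C : ℝ, ∀ U, |A U + t * B U| ≤ C := ⟨CA + |t| * CB, fun U =>
      (abs_add_le _ _).trans (add_le_add (hCA U) (by rw [abs_mul]; exact mul_le_mul_of_nonneg_left (hCB U) (abs_nonneg t)))⟩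
    have hXpos : PosHalfSupported fun U => A U + t * B U := fun U V hUV => by
      show A U + t * B U = A V + t * B V
      rw [hApos U V hUV, hBpos U V hUV]
    have hpos := expect_negReflect_mul_mul_prod_nonneg (N := N) P β hw0 hwm ⟨K, hK⟩ hXm hXb hXpos
    -- expand the quadratic form
    have hexp : (fun U => (A U.negReflect + t * B U.negReflect) * (A U + t * B U) * D U) =
        fun U => (A U.negReflect * A U * D U + (t * (A U.negReflect * B U * D U) + t * (B U.negReflect * A U * D U))) +
          t * t * (B U.negReflect * B U * D U) := by
      funext U; ring
    have hIAA := hint A A hA hA CA CA hCA hCA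
    have hIAB := hint A B hA hB CA CB hCA hCB
    have hIBA := hint B A hB hA CB CA hCB hCA
    have hIBB := hint B B hB hB CB CB hCB hCB
    have hImid : Integrable (fun U => (t * (A U.negReflect * B U * D U) + t * (B U.negReflect * A U * D U)) *
        Missing.boltzmann P β U) (fieldMeasure P 0 (Matrix.specialUnitaryGroup (Fin N) ℂ)) := by
      have h1 := (hIAB.const_mul t).add (hIBA.const_mul t)
      refine h1.congr (ae_of_all _ fun U => ?_)
      simp only [Pi.add_apply]
      ring
    have hIlast : Integrable (fun U => (t * t * (B U.negReflect * B U * D U)) * Missing.boltzmann P β U)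
        (fieldMeasure P 0 (Matrix.specialUnitaryGroup (Fin N) ℂ)) := by
      refine (hIBB.const_mul (t * t)).congr (ae_of_all _ fun U => ?_)
      simp only
      ring
    have hIfirst : Integrable (fun U => (A U.negReflect * A U * D U +
        (t * (A U.negReflect * B U * D U) + t * (B U.negReflect * A U * D U))) * Missing.boltzmann P β U)
        (fieldMeasure P 0 (Matrix.specialUnitaryGroup (Fin N) ℂ)) := by
      refine (hIAA.add hImid).congr (ae_of_all _ fun U => ?_)
      simp only [Pi.add_apply]
      ring
    rw [hexp, expect_add_of_integrable P β hIfirst hIlast, expect_add_of_integrable P β hIAA hImid,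
      expect_const_mul] at hpos
    have hI1 : Integrable (fun U => (t * (A U.negReflect * B U * D U)) * Missing.boltzmann P β U)
        (fieldMeasure P 0 (Matrix.specialUnitaryGroup (Fin N) ℂ)) :=
      (hIAB.const_mul t).congr (ae_of_all _ fun U => by simp only; ring)
    have hI2 : Integrable (fun U => (t * (B U.negReflect * A U * D U)) * Missing.boltzmann P β U)
        (fieldMeasure P 0 (Matrix.specialUnitaryGroup (Fin N) ℂ)) :=
      (hIBA.const_mul t).congr (ae_of_all _ fun U => by simp only; ring)
    have hmid : Missing.expect (G := Matrix.specialUnitaryGroup (Fin N) ℂ) P β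
        (fun U => t * (A U.negReflect * B U * D U) + t * (B U.negReflect * A U * D U)) = t * pAB + t * pBA := by
      rw [expect_add_of_integrable P β hI1 hI2, expect_const_mul, expect_const_mul]
    rw [hmid, hsymm] at hpos
    have : pAA + (t * pAB + t * pAB) + t * t * pBB = pBB * (t * t) + 2 * pAB * t + pAA := by ring
    linarith [hpos, this.symm.le, this.le]
  have hdisc := discrim_le_zero hquad
  rw [discrim] at hdisc
  nlinarith [hdisc]

end CauchySchwarz


/-! ## §2 (v1.1) EVERY SITE HYPERPLANE: the translation conjugates `τ_a ∘ Θ' ∘ τ_{−a}` (translations are exact symmetries of the torus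
expectation, `TorusLimitAxioms.Missing.expect_translate`; the all-plaquette weight is translation invariant, `GaugeField.plaqHol_translate` +
`Plaq.translateEquiv`) — positivity AND Cauchy–Schwarz at every hyperplane `t = a₀`, `t = a₀ + N₀∕2` -/

section AllHyperplanes

variable {N : ℕ} [NeZero N]

/-- The all-plaquette weight is invariant under translations of the configuration. [folklore] -/
theorem prod_plaqWeight_translate (P : Params) (w : ℝ → ℝ) (a : Balaban1983to89.Site P 0)
    (V : GaugeField P 0 (Matrix.specialUnitaryGroup (Fin N) ℂ)) :
    ∏ p : Plaq P 0, w (1 - reTr (GaugeField.plaqHol (V.translate a) p)) =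
      ∏ p : Plaq P 0, w (1 - reTr (GaugeField.plaqHol V p)) := by
  simp_rw [GaugeField.plaqHol_translate]
  exact Fintype.prod_equiv (Plaq.translateEquiv a) _ _ fun p => rfl

omit [NeZero N] in
/-- `τ_a ∘ τ_{−a} = id` on configurations. [folklore] -/
theorem translate_translate_neg (P : Params) (a : Balaban1983to89.Site P 0) (V : GaugeField P 0 (Matrix.specialUnitaryGroup (Fin N) ℂ)) :
    (V.translate a).translate (-a) = V := by
  rw [GaugeField.translate_translate, neg_add_cancel]
  funext b
  cases b
  simp [GaugeField.translate, PBond.translate]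

/-- **REFLECTION POSITIVITY AT EVERY SITE HYPERPLANE**: for a lattice vector `a`, the conjugate site reflection `R_a U := τ_a(Θ'(τ_{−a}U))`
(= the Osterwalder–Seiler reflection in the hyperplanes `t = a₀`, `t = a₀ + N₀∕2`; in `GaugeField.translate`'s pull-back convention
`R_a U = ((U.translate (−a)).negReflect).translate a`) satisfies `0 ≤ ⟨(F ∘ R_a)·F·∏_p w(1 − Re tr U(∂p))⟩_{P,β}` for every non-negative bounded
measurable `w` and every bounded measurable `F` whose pull-back `F ∘ τ_a` is positive-half supported (module 8 §2 transported by `expect_translate`).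
[folklore] -/
theorem expect_conjTranslateNegReflect_mul_mul_prod_nonneg (P : Params) (β : ℝ) (a : Balaban1983to89.Site P 0) {w : ℝ → ℝ}
    (hw0 : ∀ t, 0 ≤ w t) (hwm : Measurable w) (hwb : ∃ K : ℝ, ∀ t, w t ≤ K)
    {F : GaugeField P 0 (Matrix.specialUnitaryGroup (Fin N) ℂ) → ℝ} (hF : Measurable F)
    (hFb : ∃ C : ℝ, ∀ U, |F U| ≤ C) (hFpos : PosHalfSupported fun V => F (V.translate a)) :
    0 ≤ Missing.expect (G := Matrix.specialUnitaryGroup (Fin N) ℂ) P β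
      (fun U => F (((U.translate (-a)).negReflect).translate a) * F U * ∏ p : Plaq P 0, w (1 - reTr (GaugeField.plaqHol U p))) := by
  have hFτm : Measurable fun V : GaugeField P 0 (Matrix.specialUnitaryGroup (Fin N) ℂ) => F (V.translate a) :=
    hF.comp (GaugeField.measurePreserving_translate (G := Matrix.specialUnitaryGroup (Fin N) ℂ) a).measurable
  have hFτb : ∃ C : ℝ, ∀ V : GaugeField P 0 (Matrix.specialUnitaryGroup (Fin N) ℂ), |F (V.translate a)| ≤ C := by
    obtain ⟨C, hC⟩ := hFb
    exact ⟨C, fun V => hC _⟩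
  have h := expect_negReflect_mul_mul_prod_nonneg (N := N) P β hw0 hwm hwb hFτm hFτb hFpos
  rw [← Missing.expect_translate P β a]
  refine h.trans_eq (congrArg _ (funext fun V => ?_))
  rw [translate_translate_neg, prod_plaqWeight_translate]

/-- **REFLECTION CAUCHY–SCHWARZ AT EVERY SITE HYPERPLANE** (`β ≥ 0`): with `R_a` as above and `A`, `B` bounded measurable with positive-half
supported pull-backs `A ∘ τ_a`, `B ∘ τ_a`: `⟨(A∘R_a)·B·∏w⟩² ≤ ⟨(A∘R_a)·A·∏w⟩·⟨(B∘R_a)·B·∏w⟩` (§1 transported by `expect_translate`). [folklore] -/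
theorem expect_conjTranslate_pairing_sq_le (P : Params) {β : ℝ} (hβ : 0 ≤ β) (a : Balaban1983to89.Site P 0) {w : ℝ → ℝ}
    (hw0 : ∀ t, 0 ≤ w t) (hwm : Measurable w) (hwb : ∃ K : ℝ, ∀ t, w t ≤ K)
    {A B : GaugeField P 0 (Matrix.specialUnitaryGroup (Fin N) ℂ) → ℝ} (hA : Measurable A) (hAb : ∃ C : ℝ, ∀ U, |A U| ≤ C)
    (hApos : PosHalfSupported fun V => A (V.translate a)) (hB : Measurable B) (hBb : ∃ C : ℝ, ∀ U, |B U| ≤ C)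
    (hBpos : PosHalfSupported fun V => B (V.translate a)) :
    Missing.expect (G := Matrix.specialUnitaryGroup (Fin N) ℂ) P β
        (fun U => A (((U.translate (-a)).negReflect).translate a) * B U * ∏ p : Plaq P 0, w (1 - reTr (GaugeField.plaqHol U p))) ^ 2 ≤
      Missing.expect (G := Matrix.specialUnitaryGroup (Fin N) ℂ) P β
          (fun U => A (((U.translate (-a)).negReflect).translate a) * A U * ∏ p : Plaq P 0, w (1 - reTr (GaugeField.plaqHol U p))) *
        Missing.expect (G := Matrix.specialUnitaryGroup (Fin N) ℂ) P β
          (fun U => B (((U.translate (-a)).negReflect).translate a) * B U * ∏ p : Plaq P 0, w (1 - reTr (GaugeField.plaqHol U p))) := by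
  have hτm := (GaugeField.measurePreserving_translate (P := P) (j := 0) (G := Matrix.specialUnitaryGroup (Fin N) ℂ) a).measurable
  have hAτm : Measurable fun V : GaugeField P 0 (Matrix.specialUnitaryGroup (Fin N) ℂ) => A (V.translate a) := hA.comp hτm
  have hBτm : Measurable fun V : GaugeField P 0 (Matrix.specialUnitaryGroup (Fin N) ℂ) => B (V.translate a) := hB.comp hτm
  have hAτb : ∃ C : ℝ, ∀ V : GaugeField P 0 (Matrix.specialUnitaryGroup (Fin N) ℂ), |A (V.translate a)| ≤ C := by
    obtain ⟨C, hC⟩ := hAb; exact ⟨C, fun V => hC _⟩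
  have hBτb : ∃ C : ℝ, ∀ V : GaugeField P 0 (Matrix.specialUnitaryGroup (Fin N) ℂ), |B (V.translate a)| ≤ C := by
    obtain ⟨C, hC⟩ := hBb; exact ⟨C, fun V => hC _⟩
  have h := expect_negReflect_pairing_sq_le (N := N) P hβ hw0 hwm hwb hAτm hAτb hApos hBτm hBτb hBpos
  have key : ∀ (X Y : GaugeField P 0 (Matrix.specialUnitaryGroup (Fin N) ℂ) → ℝ),
      Missing.expect (G := Matrix.specialUnitaryGroup (Fin N) ℂ) P β
          (fun U => X (((U.translate (-a)).negReflect).translate a) * Y U * ∏ p : Plaq P 0, w (1 - reTr (GaugeField.plaqHol U p))) =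
        Missing.expect (G := Matrix.specialUnitaryGroup (Fin N) ℂ) P β
          (fun V => X ((V.negReflect).translate a) * Y (V.translate a) * ∏ p : Plaq P 0, w (1 - reTr (GaugeField.plaqHol V p))) := by
    intro X Y
    rw [← Missing.expect_translate P β a]
    exact congrArg _ (funext fun V => by rw [translate_translate_neg, prod_plaqWeight_translate])
  rw [key A B, key A A, key B B]
  exact h

end AllHyperplanes


/-! ## §3 (v1.1) THE CHESSBOARD STEP'S INPUT SHAPE: products of one-plaquette functions over POSITIVE plaquettes are positive-half supported,
so §1 applies to them verbatim -/

section PosProducts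

variable {N : ℕ} [NeZero N]

/-- A product of one-plaquette functions over plaquettes whose host images are POSITIVE (`WilsonSiteRP.IsSitePosPlaq ∘ plaqEquiv`) is supported
in the closed positive-time half (`plaqRe_congr_of_isSitePosPlaq` of module 8 + `isPosHalfBond_of_pos_or_shared`). [folklore] -/
theorem posHalfSupported_prod_of_pos (P : Params) (f : ℝ → ℝ) (T : Finset (Plaq P 0))
    (hT : ∀ p ∈ T, WilsonSiteRP.IsSitePosPlaq (plaqEquiv 0 p)) :
    PosHalfSupported fun U : GaugeField P 0 (Matrix.specialUnitaryGroup (Fin N) ℂ) =>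
      ∏ p ∈ T, f (1 - reTr (GaugeField.plaqHol U p)) := by
  intro U V hUV
  have hL : Even (P.sitesPerDir 0) := even_sitesPerDir P 0
  have hUV' : ∀ e : Edge P.d (P.sitesPerDir 0), WilsonSiteRP.IsSitePosEdge e ∨ WilsonSiteRP.IsSharedEdge e →
      toConfig U e = toConfig V e :=
    fun e he => hUV ⟨e.1, e.2⟩ (N20LCSRestrictedRP.isPosHalfBond_of_pos_or_shared P he)
  refine Finset.prod_congr rfl fun p hp => ?_
  rw [N20LCSRestrictedRP.one_sub_reTr_eq P U p, N20LCSRestrictedRP.one_sub_reTr_eq P V p,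
    N20LCSRestrictedRP.plaqRe_congr_of_isSitePosPlaq (Literature.MathematicalPhysics.QuantumLattice.fundamentalRep (Fin N)) hL hUV'
      (hT p hp)]

/-- The product observable is measurable. [folklore] -/
theorem measurable_prod_plaq (P : Params) {f : ℝ → ℝ} (hfm : Measurable f) (T : Finset (Plaq P 0)) :
    Measurable fun U : GaugeField P 0 (Matrix.specialUnitaryGroup (Fin N) ℂ) => ∏ p ∈ T, f (1 - reTr (GaugeField.plaqHol U p)) :=
  Finset.measurable_prod _ fun p _ =>
    hfm.comp (measurable_const.sub (RegularGaugeGroup.measurable_reTr.comp (Missing.measurable_plaqHol p)))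

/-- The product observable is bounded by `K^{#T}` when `0 ≤ f ≤ K`. [folklore] -/
theorem abs_prod_plaq_le (P : Params) {f : ℝ → ℝ} (hf0 : ∀ t, 0 ≤ f t) {K : ℝ} (hfK : ∀ t, f t ≤ K) (T : Finset (Plaq P 0))
    (U : GaugeField P 0 (Matrix.specialUnitaryGroup (Fin N) ℂ)) :
    |∏ p ∈ T, f (1 - reTr (GaugeField.plaqHol U p))| ≤ K ^ T.card := by
  rw [Finset.abs_prod, ← Finset.prod_const]
  exact Finset.prod_le_prod (fun p _ => abs_nonneg _) fun p _ => by rw [abs_of_nonneg (hf0 _)]; exact hfK _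

/-- **THE REFLECTION CAUCHY–SCHWARZ STEP FOR POSITIVE-PLAQUETTE PRODUCTS** (the shape a chessboard iteration consumes, Friedli–Velenik
Thm. 10.11 ∕ FILS Thm. 4.1 step): for `β ≥ 0`, a weight `w ≥ 0` and a one-plaquette function `0 ≤ f ≤ K`, and two finite sets `T₁`, `T₂` of
level-0 plaquettes with POSITIVE host images,
`⟨(∏_{T₁} f)∘Θ' · ∏_{T₂} f · ∏_p w⟩² ≤ ⟨(∏_{T₁} f)∘Θ' · ∏_{T₁} f · ∏_p w⟩ · ⟨(∏_{T₂} f)∘Θ' · ∏_{T₂} f · ∏_p w⟩`. [folklore] -/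
theorem expect_negReflect_prodPos_sq_le (P : Params) {β : ℝ} (hβ : 0 ≤ β) {w : ℝ → ℝ} (hw0 : ∀ t, 0 ≤ w t) (hwm : Measurable w)
    (hwb : ∃ K : ℝ, ∀ t, w t ≤ K) {f : ℝ → ℝ} (hf0 : ∀ t, 0 ≤ f t) (hfm : Measurable f) (hfb : ∃ K : ℝ, ∀ t, f t ≤ K)
    (T₁ T₂ : Finset (Plaq P 0)) (hT₁ : ∀ p ∈ T₁, WilsonSiteRP.IsSitePosPlaq (plaqEquiv 0 p))
    (hT₂ : ∀ p ∈ T₂, WilsonSiteRP.IsSitePosPlaq (plaqEquiv 0 p)) :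
    Missing.expect (G := Matrix.specialUnitaryGroup (Fin N) ℂ) P β
        (fun U => (∏ p ∈ T₁, f (1 - reTr (GaugeField.plaqHol U.negReflect p))) * (∏ p ∈ T₂, f (1 - reTr (GaugeField.plaqHol U p))) *
          ∏ p : Plaq P 0, w (1 - reTr (GaugeField.plaqHol U p))) ^ 2 ≤
      Missing.expect (G := Matrix.specialUnitaryGroup (Fin N) ℂ) P β
          (fun U => (∏ p ∈ T₁, f (1 - reTr (GaugeField.plaqHol U.negReflect p))) * (∏ p ∈ T₁, f (1 - reTr (GaugeField.plaqHol U p))) *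
            ∏ p : Plaq P 0, w (1 - reTr (GaugeField.plaqHol U p))) *
        Missing.expect (G := Matrix.specialUnitaryGroup (Fin N) ℂ) P β
          (fun U => (∏ p ∈ T₂, f (1 - reTr (GaugeField.plaqHol U.negReflect p))) * (∏ p ∈ T₂, f (1 - reTr (GaugeField.plaqHol U p))) *
            ∏ p : Plaq P 0, w (1 - reTr (GaugeField.plaqHol U p))) := by
  obtain ⟨K, hK⟩ := hfb
  exact expect_negReflect_pairing_sq_le (N := N) P hβ hw0 hwm hwb
    (A := fun U => ∏ p ∈ T₁, f (1 - reTr (GaugeField.plaqHol U p)))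
    (B := fun U => ∏ p ∈ T₂, f (1 - reTr (GaugeField.plaqHol U p)))
    (measurable_prod_plaq P hfm T₁) ⟨K ^ T₁.card, abs_prod_plaq_le P hf0 hK T₁⟩ (posHalfSupported_prod_of_pos P f T₁ hT₁)
    (measurable_prod_plaq P hfm T₂) ⟨K ^ T₂.card, abs_prod_plaq_le P hf0 hK T₂⟩ (posHalfSupported_prod_of_pos P f T₂ hT₂)

end PosProducts

end Summit.QuantumFields.YangMills.BalabanUVNodes.N20LCSRestrictedRPCauchySchwarz

end
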